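import Literature.AnabelianGeometry.EtaleTheta.BiKummerRootTransport

/-!
# [EtTh] §4: `NthRoot.transportAt` — the re-anchored `Ψ`-image root with clause (e) of Def 4.1 (iv) bound
# POINTWISE, and Prop 4.2 (iv) AT THE PAIR (sequel of `BiKummerRootTransport.lean`, rows R192 of plan/L2)

S. Mochizuki, *The étale theta function and its Frobenioid-theoretic manifestations*, Publ. RIMS **45** (2009)
[cite: MochizukiEtTh2009, Def 4.1 (iv) p.313 (PDF p.87); Prop 4.2 (iii)(iv) p.314–315 (PDF pp.88–89); Rmk 4.3.2
p.318–319 (PDF pp.92–93); Thm 4.4 (ii) p.320 (PDF p.94)].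

abc-iut cell, layer L2, row R192 (B′) hardening, seat abc-iut-f-121.  WHY.  `NthRoot.transport` (p434632) binds the
stability of Def 4.1 (iv) clause (e) "arise from a base-Frobenius pair" under post-composition with an isomorphism of
the codomain UNIVERSALLY (`∀ G α″ α′ e, …`).  At abc-iut-L2-t3's canonical model
(`TemperedFrobenioid.ArisesFromBaseFrobeniusPair`, `BiKummerOfModelCanonical.lean`) clause (e) reads "`α′` is
`P`-distinguished" for a base-section `P` ([FrdI] Def 2.7 (i): `IsDistinguished P f := P.hom f`), which is stable
under `α′ ↦ α′ ≫ e` exactly when `e` itself lies in `P` (`Presection.hom_comp`) — so the universal binder is NOT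
dischargeable at the genuine data, whereas its instance at the ONE anchor `eA` actually used is (for a
`P`-distinguished anchor).  This file therefore re-exposes the construction with the POINTWISE binder
`hArises : Arises (Ψ G) (Ψ α″) (Ψ α′ ≫ eA)` — `NthRoot.transportAt` — with the same field lemmas, and restates the
Prop 4.2 (iv) consequences of `Discharge/Sec4RootTransportUniqueness.lean` for it, with Prop 4.2 (iv) bound AT THE
GIVEN PAIR (`hivP`, any domain; `= Prop42_iv` when the domain is `A_⊙`).  Definitions + kernel-checked identities;
every [FrdI]/[EtTh] input is a NAMED binder; refereed pre-IUT material; nothing here bears on [IUTchIII] Cor. 3.12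
or takes a side; typed ≠ proved for any genuine datum.
-/

noncomputable section

namespace Literature.AnabelianGeometry.EtaleTheta

open CategoryTheory Opposite Literature.AlgebraicGeometry.Frobenioids

namespace BiKummerSetting

universe u₀ v₀ u v w

variable {K : Type u₀} [Field K] {K' : Type u₀} [Field K'] {D₀ : Type u₀} [Category.{v₀} D₀]
  {V : FrdIMonoidStub.{w}}
  {X₁ : SemiGraphs.TemperedArithmeticGroup.{u₀} K} {X₂ : SemiGraphs.TemperedArithmeticGroup.{u₀} K'}
  {D₀' : Type u₀} [Category.{v₀} D₀']
  {T₁ : RealifiedDivisorMonoids (D₀ := D₀) V} {T₂ : RealifiedDivisorMonoids (D₀ := D₀') V}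
  {D₁ D₂ : Type u} [Category.{v} D₁] [Category.{v} D₂] {VD₁ : FrdICatStub.{u, v, w} D₁}
  {VD₂ : FrdICatStub.{u, v, w} D₂} {S₁ : BiKummerSetting X₁ T₁ D₁ VD₁} {S₂ : BiKummerSetting X₂ T₂ D₂ VD₂}
  {S : BiKummerSetting X₁ T₁ D₁ VD₁}

namespace NthRoot

/-! ### §1. `NthRoot.transportAt`: clause (e) bound at the anchor only -/

section transportAt

variable (h : Thm44Hyp S₁ S₂) (ψ : ∀ A : S₁.C, S₁.biratUnits A ≃* S₂.biratUnits (h.Ψ.functor.obj A))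
    {pullFrac₁ : ∀ {A A' : S₁.C} (_ : A' ⟶ A), S₁.biratUnits A → S₁.biratUnits A'}
    (pullFrac₂ : ∀ {A A' : S₂.C} (_ : A' ⟶ A), S₂.biratUnits A → S₂.biratUnits A')
    (hpull : ∀ {A A' : S₁.C} (φ : A' ⟶ A) (f : S₁.biratUnits A),
      ψ A' (pullFrac₁ φ f) = pullFrac₂ (h.Ψ.functor.map φ) (ψ A f))
    (hii : Thm44_ii h ψ) (h3 : h.PreservesFrobeniusStructure) (h4b : h.PreservesBaseFrobeniusTypeData)
    (h8 : h.PreservesAmple) (h15a : h.PreservesFixedByHA ψ) (h15 : h.PreservesSaturated ψ)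
    {A B : S₁.C} {f : S₁.biratUnits A} {P : S₁.FractionPair f B} {N : ℕ+} (R : S₁.NthRoot f P N pullFrac₁)
    {A₂ B₂ : S₂.C} (eA : h.Ψ.functor.obj A ≅ A₂) (eB : h.Ψ.functor.obj B ≅ B₂) {f₂ : S₂.biratUnits A₂}
    (P₂ : S₂.FractionPair f₂ B₂)
    (hnum : eA.inv ≫ h.Ψ.functor.map P.num ≫ eB.hom = P₂.num) (hden : eA.inv ≫ h.Ψ.functor.map P.den ≫ eB.hom = P₂.den)
    (hf : pullFrac₂ eA.hom f₂ = ψ A f) (heA : S₂.IsIsometry eA.hom) (heB : S₂.IsIsometry eB.hom)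
    (hArises : S₂.ArisesFromBaseFrobeniusPair (R.αData.G.map (h.Ψ.functor.mapAut R.AN))
      (h.Ψ.functor.map R.αData.α₂) (h.Ψ.functor.map R.αData.α₁ ≫ eA.hom))
    (hpull₂ : ∀ {X Y Z : S₂.C} (φ : X ⟶ Y) (χ : Y ⟶ Z) (g : S₂.biratUnits Z),
      pullFrac₂ (φ ≫ χ) g = pullFrac₂ φ (pullFrac₂ χ g))

include hArises in
/-- Clause (e) for the CHOSEN transported Def 4.1 (iv) data (T44-L04b) at the anchor, from the pointwise binder.
[cite: MochizukiEtTh2009, Def 4.1 (iv) p.313 (PDF p.87)] -/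
theorem arises_map_αData_compIso :
    S₂.ArisesFromBaseFrobeniusPair
      (R.map h ψ pullFrac₂ hpull hii h3 h4b h8 h15a h15 (Classical.choose (hii f P))
        (Classical.choose_spec (hii f P)).1 (Classical.choose_spec (hii f P)).2).αData.G
      (R.map h ψ pullFrac₂ hpull hii h3 h4b h8 h15a h15 (Classical.choose (hii f P))
        (Classical.choose_spec (hii f P)).1 (Classical.choose_spec (hii f P)).2).αData.α₂
      ((R.map h ψ pullFrac₂ hpull hii h3 h4b h8 h15a h15 (Classical.choose (hii f P))
        (Classical.choose_spec (hii f P)).1 (Classical.choose_spec (hii f P)).2).αData.α₁ ≫ eA.hom) := by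
  rw [map_αData_G, map_αData_α₂, map_αData_α₁]
  exact hArises

/-- **`NthRoot.transportAt`** — `NthRoot.transport` (p434632: "`Ψ` of a root diagram is a root diagram of the
transported pair, re-anchored at `(eA, eB)`") with clause (e) of Def 4.1 (iv) bound ONLY at the anchor `eA`:
`hArises : Arises (Ψ G) (Ψ α″) (Ψ α′ ≫ eA)`.  Same fields: `(Ψ A_N, Ψ B_N, Ψ α ≫ eA, Ψ β ≫ eB, ψ f_N, (Ψ s′_N, Ψ s″_N))`.
[cite: MochizukiEtTh2009, Rmk 4.3.2 p.318–319 (PDF pp.92–93); Thm 4.4 (ii) p.320 (PDF p.94)] -/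
def transportAt : S₂.NthRoot f₂ P₂ N pullFrac₂ :=
  (R.map h ψ pullFrac₂ hpull hii h3 h4b h8 h15a h15 (Classical.choose (hii f P)) (Classical.choose_spec (hii f P)).1
      (Classical.choose_spec (hii f P)).2).reanchor eA eB P₂
    (by rw [(Classical.choose_spec (hii f P)).1]; exact hnum) (by rw [(Classical.choose_spec (hii f P)).2]; exact hden)
    hf heA heB
    (arises_map_αData_compIso h ψ pullFrac₂ hpull hii h3 h4b h8 h15a h15 R eA hArises) hpull₂

/-- `N`-domain: `Ψ A_N`. [cite: MochizukiEtTh2009, Thm 4.4 (ii) p.320 (PDF p.94)] -/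
@[simp] theorem transportAt_AN :
    (R.transportAt h ψ pullFrac₂ hpull hii h3 h4b h8 h15a h15 eA eB P₂ hnum hden hf heA heB hArises hpull₂).AN =
      h.Ψ.functor.obj R.AN := rfl

/-- `N`-codomain: `Ψ B_N`. [cite: MochizukiEtTh2009, Thm 4.4 (ii) p.320 (PDF p.94)] -/
@[simp] theorem transportAt_BN :
    (R.transportAt h ψ pullFrac₂ hpull hii h3 h4b h8 h15a h15 eA eB P₂ hnum hden hf heA heB hArises hpull₂).BN =
      h.Ψ.functor.obj R.BN := rfl

/-- `α`: `Ψ α ≫ eA`. [cite: MochizukiEtTh2009, Rmk 4.3.2 p.319 (PDF p.93)] -/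
@[simp] theorem transportAt_α :
    (R.transportAt h ψ pullFrac₂ hpull hii h3 h4b h8 h15a h15 eA eB P₂ hnum hden hf heA heB hArises hpull₂).α =
      h.Ψ.functor.map R.α ≫ eA.hom := rfl

/-- `β`: `Ψ β ≫ eB`. [cite: MochizukiEtTh2009, Rmk 4.3.2 p.319 (PDF p.93)] -/
@[simp] theorem transportAt_β :
    (R.transportAt h ψ pullFrac₂ hpull hii h3 h4b h8 h15a h15 eA eB P₂ hnum hden hf heA heB hArises hpull₂).β =
      h.Ψ.functor.map R.β ≫ eB.hom := rfl

/-- `f_N`: `ψ f_N`. [cite: MochizukiEtTh2009, Thm 4.4 (ii) p.320 (PDF p.94)] -/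
@[simp] theorem transportAt_root :
    (R.transportAt h ψ pullFrac₂ hpull hii h3 h4b h8 h15a h15 eA eB P₂ hnum hden hf heA heB hArises hpull₂).root =
      ψ R.AN R.root := rfl

/-- `s′_N`: `Ψ s′_N`. [cite: MochizukiEtTh2009, Thm 4.4 (ii) p.320 (PDF p.94)] -/
theorem transportAt_pair_num :
    (R.transportAt h ψ pullFrac₂ hpull hii h3 h4b h8 h15a h15 eA eB P₂ hnum hden hf heA heB hArises hpull₂).pair.num =
      h.Ψ.functor.map R.pair.num :=
  R.map_pair_num h ψ pullFrac₂ hpull hii h3 h4b h8 h15a h15 (Classical.choose (hii f P))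
    (Classical.choose_spec (hii f P)).1 (Classical.choose_spec (hii f P)).2

/-- `s″_N`: `Ψ s″_N`. [cite: MochizukiEtTh2009, Thm 4.4 (ii) p.320 (PDF p.94)] -/
theorem transportAt_pair_den :
    (R.transportAt h ψ pullFrac₂ hpull hii h3 h4b h8 h15a h15 eA eB P₂ hnum hden hf heA heB hArises hpull₂).pair.den =
      h.Ψ.functor.map R.pair.den :=
  R.map_pair_den h ψ pullFrac₂ hpull hii h3 h4b h8 h15a h15 (Classical.choose (hii f P))
    (Classical.choose_spec (hii f P)).1 (Classical.choose_spec (hii f P)).2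

/-- `α′`: `Ψ α′ ≫ eA`. [cite: MochizukiEtTh2009, Prop 4.2 (iii) p.314 (PDF p.88)] -/
theorem transportAt_αData_α₁ :
    (R.transportAt h ψ pullFrac₂ hpull hii h3 h4b h8 h15a h15 eA eB P₂ hnum hden hf heA heB hArises hpull₂).αData.α₁ =
      h.Ψ.functor.map R.αData.α₁ ≫ eA.hom := by
  show (Classical.choose (h4b R.α R.αData)).α₁ ≫ eA.hom = _
  rw [(Classical.choose_spec (h4b R.α R.αData)).2.2]

end transportAt

/-! ### §2. Prop 4.2 (iv) at `(R, R.transportAt …)` — coherent isomorphisms of root diagrams (self-case, any domain) -/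

section coherent

variable (h : Thm44Hyp S S) (ψ : ∀ A : S.C, S.biratUnits A ≃* S.biratUnits (h.Ψ.functor.obj A))
    (pullFrac : ∀ {A A' : S.C} (_ : A' ⟶ A), S.biratUnits A → S.biratUnits A')
    (hpull : ∀ {A A' : S.C} (φ : A' ⟶ A) (f : S.biratUnits A),
      ψ A' (pullFrac φ f) = pullFrac (h.Ψ.functor.map φ) (ψ A f))
    (hii : Thm44_ii h ψ) (h3 : h.PreservesFrobeniusStructure) (h4b : h.PreservesBaseFrobeniusTypeData)
    (h8 : h.PreservesAmple) (h15a : h.PreservesFixedByHA ψ) (h15 : h.PreservesSaturated ψ)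
    {A B : S.C} {f : S.biratUnits A} {P : S.FractionPair f B} {N : ℕ+}
    (hivP : ∀ (R R' : S.NthRoot f P N pullFrac) (ebs : S.base.obj R.AN ≅ S.base.obj R'.AN),
      S.base.map R.α = ebs.hom ≫ S.base.map R'.α →
        ∃ (u : S.mu R.BN N) (ζA : R.AN ≅ R'.AN) (ζB : R.BN ≅ R'.BN),
          ζA.hom ≫ R'.pair.num = R.pair.num ≫ ζB.hom ∧
          ζA.hom ≫ R'.pair.den = (R.pair.den ≫ (u : Aut R.BN).hom) ≫ ζB.hom ∧
          ζA.hom ≫ R'.α = R.α ∧ ζB.hom ≫ R'.β = R.β ∧ S.base.mapIso ζA = ebs)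
    (R : S.NthRoot f P N pullFrac)
    (eA : h.Ψ.functor.obj A ≅ A) (eB : h.Ψ.functor.obj B ≅ B)
    (hnum : eA.inv ≫ h.Ψ.functor.map P.num ≫ eB.hom = P.num) (hden : eA.inv ≫ h.Ψ.functor.map P.den ≫ eB.hom = P.den)
    (hf : pullFrac eA.hom f = ψ A f) (heA : S.IsIsometry eA.hom) (heB : S.IsIsometry eB.hom)
    (hArises : S.ArisesFromBaseFrobeniusPair (R.αData.G.map (h.Ψ.functor.mapAut R.AN))
      (h.Ψ.functor.map R.αData.α₂) (h.Ψ.functor.map R.αData.α₁ ≫ eA.hom))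
    (hpull₂ : ∀ {X Y Z : S.C} (φ : X ⟶ Y) (χ : Y ⟶ Z) (g : S.biratUnits Z),
      pullFrac (φ ≫ χ) g = pullFrac φ (pullFrac χ g))
    (ebs : S.base.obj R.AN ≅ S.base.obj (h.Ψ.functor.obj R.AN))
    (hebs : S.base.map R.α = ebs.hom ≫ S.base.map (h.Ψ.functor.map R.α ≫ eA.hom))

include ψ hpull hii h3 h4b h8 h15a h15 hivP hnum hden hf heA heB hArises hpull₂ hebs in
/-- **Prop 4.2 (iv) (clause at the pair) at `(R, R.transportAt …)` — the COHERENT transport datum**, clause (e) bound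
at the anchor only: `a : Ψ A_N ≅ A_N`, `b : Ψ B_N ≅ B_N`, `u ∈ μ_N(B_N) (⊆ O^×(B_N))` with `a⁻¹ ≫ Ψ α ≫ eA = α`,
`b⁻¹ ≫ Ψ β ≫ eB = β`, `a⁻¹ ≫ Ψ s′_N ≫ b = s′_N`, `a⁻¹ ≫ Ψ s″_N ≫ b = s″_N ≫ u`, `Base(a) = ebs⁻¹` — i.e. the
§5 per-level datum `(a, b, e := 1, D_c := 1, D_p := u)` of abc-iut-L2-d4's `Sec5Thm57ChosenFamily.lean` together
with its compatibility with the structural maps (cf. `unit_transport_of_coherent`).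
[cite: MochizukiEtTh2009, Prop 4.2 (iv) p.315 (PDF p.89); Rmk 4.3.2 p.318–319 (PDF pp.92–93); Thm 5.7 proof p.330 (PDF p.104)] -/
theorem exists_coherent_transport_at :
    ∃ (a : h.Ψ.functor.obj R.AN ≅ R.AN) (b : h.Ψ.functor.obj R.BN ≅ R.BN) (u : Aut R.BN),
      u ∈ S.mu R.BN N ∧ u ∈ S.units R.BN ∧
      a.inv ≫ h.Ψ.functor.map R.α ≫ eA.hom = R.α ∧
      b.inv ≫ h.Ψ.functor.map R.β ≫ eB.hom = R.β ∧
      a.inv ≫ h.Ψ.functor.map R.pair.num ≫ b.hom = R.pair.num ∧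
      a.inv ≫ h.Ψ.functor.map R.pair.den ≫ b.hom = R.pair.den ≫ u.hom ∧
      S.base.mapIso a = ebs.symm := by
  obtain ⟨u, ζA, ζB, h₁, h₂, h₃, h₄, h₅⟩ := hivP R
    (R.transportAt h ψ pullFrac hpull hii h3 h4b h8 h15a h15 eA eB P hnum hden hf heA heB hArises hpull₂) ebs hebs
  rw [transportAt_pair_num] at h₁
  rw [transportAt_pair_den] at h₂
  rw [transportAt_α] at h₃
  rw [transportAt_β] at h₄
  have h₁' : (ζA.hom : R.AN ⟶ h.Ψ.functor.obj R.AN) ≫ h.Ψ.functor.map R.pair.num =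
      R.pair.num ≫ (ζB.hom : R.BN ⟶ h.Ψ.functor.obj R.BN) := h₁
  have h₂' : (ζA.hom : R.AN ⟶ h.Ψ.functor.obj R.AN) ≫ h.Ψ.functor.map R.pair.den =
      (R.pair.den ≫ (u : Aut R.BN).hom) ≫ (ζB.hom : R.BN ⟶ h.Ψ.functor.obj R.BN) := h₂
  have h₃' : (ζA.hom : R.AN ⟶ h.Ψ.functor.obj R.AN) ≫ h.Ψ.functor.map R.α ≫ eA.hom = R.α := h₃
  have h₄' : (ζB.hom : R.BN ⟶ h.Ψ.functor.obj R.BN) ≫ h.Ψ.functor.map R.β ≫ eB.hom = R.β := h₄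
  have h₅' : S.base.mapIso (ζA : R.AN ≅ h.Ψ.functor.obj R.AN) = ebs := h₅
  refine ⟨(ζA : R.AN ≅ h.Ψ.functor.obj R.AN).symm, (ζB : R.BN ≅ h.Ψ.functor.obj R.BN).symm, (u : Aut R.BN),
    u.2, u.2.1, ?_, ?_, ?_, ?_, ?_⟩
  · rw [Iso.symm_inv]; exact h₃'
  · rw [Iso.symm_inv]; exact h₄'
  · rw [Iso.symm_inv, Iso.symm_hom, ← Category.assoc]
    exact (Iso.comp_inv_eq _).mpr h₁'
  · rw [Iso.symm_inv, Iso.symm_hom, ← Category.assoc]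
    exact (Iso.comp_inv_eq _).mpr h₂'
  · rw [← h₅']
    exact Iso.ext rfl

end coherent

/-- **Repackaging** (no `Ψ`-hypotheses): coherent identifications `(a, b, u)` as in `exists_coherent_transport_at` ARE a
transport datum in the binder shape of abc-iut-L2-d4's `Sec5Thm57ChosenFamily.lean` with `e := 1`, `D_c := 1`,
`D_p := u`: `hT : a⁻¹ ≫ Ψ s′_N ≫ b = e ≫ s′_N ≫ D_c`, `hT′ : a⁻¹ ≫ Ψ s″_N ≫ b = e ≫ s″_N ≫ D_p`, `hu : D_c⁻¹·D_p ∈ O^×(B_N)`.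
[cite: MochizukiEtTh2009, Thm 5.7 proof p.330 (PDF p.104)] -/
theorem unit_transport_of_coherent {C' : Type*} [Category C'] (F : C' ⥤ C') {XN YN : C'}
    (a : F.obj XN ≅ XN) (b : F.obj YN ≅ YN) (sCap sCup : XN ⟶ YN) (u : Aut YN) (U : Subgroup (Aut YN))
    (hu : u ∈ U) (hcap : a.inv ≫ F.map sCap ≫ b.hom = sCap) (hcup : a.inv ≫ F.map sCup ≫ b.hom = sCup ≫ u.hom) :
    a.inv ≫ F.map sCap ≫ b.hom = (Iso.refl XN).hom ≫ sCap ≫ (1 : Aut YN).hom ∧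
      a.inv ≫ F.map sCup ≫ b.hom = (Iso.refl XN).hom ≫ sCup ≫ u.hom ∧ (1 : Aut YN)⁻¹ * u ∈ U := by
  refine ⟨?_, ?_, ?_⟩
  · rw [hcap, Iso.refl_hom, Category.id_comp]
    show sCap = sCap ≫ (Iso.refl YN).hom
    rw [Iso.refl_hom, Category.comp_id]
  · rw [hcup, Iso.refl_hom, Category.id_comp]
  · rw [inv_one, one_mul]; exact hu



end NthRoot

end BiKummerSetting

end Literature.AnabelianGeometry.EtaleTheta

end
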